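import Literature.AlgebraicGeometry.Resolution.LogRegularSharpening
import Literature.AlgebraicGeometry.Resolution.LogRegularAtlasComparison
import Literature.AlgebraicGeometry.Resolution.LogRefinedChartUnits
import Literature.Combinatorics.Optimization.HilbertBasis
import HarnessLib

/-!
# Links between the charts of a log regular atlas (Kato 1994, (10.1)–(10.4): the fan of `X` by charts)

`Literature/AlgebraicGeometry/Resolution/LogRegularAtlasLinks.lean`. In K. Kato, *Toric
singularities*, Amer. J. Math. 116 (1994), §§9–10, the resolution of a log regular scheme `X` is
read off ONE object, the fan `F(X)` with its sheaf of sharp monoids `M_{X,x}/𝒪^*_{X,x}`; a Zariski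
atlas by fs charts `φ_i : P_i → Γ(X, U_i)` (`LogRegularAtlas`) sees it chart by chart: at
`y ∈ U_i` the stalk monoid is the sharp quotient `P_i / F_{i,y}` by the face of elements that are
units at `y`, and its dual cone is the face `F_{i,y}^⊥ ∩ P_i^∨` of `σ_i = P_i^∨`. This file
constructs the LINKS between two charts at a common point `y ∈ U_i ∩ U_j` — the data by which a
subdivision of the cones `σ_i` is "one subdivision of `F(X)`":

* `primeAt`, `faceAt`, `coe_mem_faceAt_iff` — the prime of `y` in `Γ(X, U_i)` and the face
  `F_{i,y} ⊆ P_i` of chart elements invertible at `y`;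
* `sub_mem_span_faceAt_of_associated` — Nizioł's Lemma 2.4 (1) at the stalk: associated germs
  `φ_i(p)_y ~ φ_i(p')_y` force `p − p' ∈ ℤF_{i,y}` (`LogRegularSharpening.lean`);
* `Rel`, `exists_rel`, `exists_rel'`, `Rel.add`, `Rel.sub_mem_left/right` — the partner relation
  `φ_i(p)_y ~ φ_j(q)_y` between `P_i` and `P_j` (total both ways by `LogRegularAtlas.compat`,
  additive, single-valued modulo the face groups);
* `linkHom` — the induced additive map `θ : ℤ^{n_j} → ℤ^{n_i}` (a lift of `P_j → P_i/ℤF_{i,y}`,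
  `linkHom_sub_mem`), and its rational transpose `linkMap : ℚ^{n_i} → ℚ^{n_j}`
  (`dotProduct_linkMap : ⟨x, E v⟩ = ⟨θ x, v⟩`);
* **the link** `E = linkMap` on the face `F_{i,y}^⊥`: `linkMap_pairing` (`⟨q, E v⟩ = ⟨p, v⟩`
  for partners `p ~ q`), `linkMap_orth` (`E` maps `F_{i,y}^⊥` into `F_{j,y}^⊥`), `linkMap_nonneg`
  (`E` maps `F_{i,y}^⊥ ∩ σ_i` into `σ_j`), `linkMap_integral` (lattice points to lattice points),
  `linkMap_linkMap` (the link from `j` to `i` inverts it on `F_{i,y}^⊥`) — so `E` restricts to an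
  isomorphism of the faces `F_{i,y}^⊥ ∩ σ_i ≅ F_{j,y}^⊥ ∩ σ_j` with their lattices (Kato (10.1):
  both are the dual cone of `M_y/𝒪^*_y`).

References: [Kato1994] K. Kato, Toric singularities, Amer. J. Math. 116 (1994), (1.5), (10.1),
(10.4); [Niziol2006] W. Nizioł, Toric singularities: log-blow-ups and global resolutions,
J. Algebraic Geom. 15 (2006), §2.1, Lemma 2.4 (1).
-/

noncomputable section

open AlgebraicGeometry CategoryTheory TopologicalSpace Opposite
open Literature.Combinatorics.Optimization.HilbertBasis (toRat toRat_add toRat_zero)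

namespace Literature.AlgebraicGeometry.Resolution

namespace LogRegularAtlas

universe u

variable {X : Scheme.{u}} (𝒜 : LogRegularAtlas X)

/-! ### The prime and the face of a chart at a point -/

/-- The prime ideal of `Γ(X, U_i)` corresponding to the point `y ∈ U_i`. [cite: Kato1994, (1.5)] -/
def primeAt (i : 𝒜.ι) (y : X) (hy : y ∈ (𝒜.U i : X.Opens)) : Ideal Γ(X, (𝒜.U i : X.Opens)) :=
  ((𝒜.U i).2.primeIdealOf ⟨y, hy⟩).asIdeal

/-- `primeAt` is prime. [cite: Kato1994, (1.5)] -/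
instance isPrime_primeAt (i : 𝒜.ι) (y : X) (hy : y ∈ (𝒜.U i : X.Opens)) :
    (𝒜.primeAt i y hy).IsPrime :=
  ((𝒜.U i).2.primeIdealOf ⟨y, hy⟩).isPrime

/-- The **face of the chart `i` at `y`**: the chart elements `p ∈ P_i` with `φ_i(p)` a unit at `y`
(`LogChart.faceMonoid` at the prime of `y`). [cite: Kato1994, (10.1)] -/
def faceAt (i : 𝒜.ι) (y : X) (hy : y ∈ (𝒜.U i : X.Opens)) : AddSubmonoid (Fin (𝒜.n i) → ℤ) :=
  LogChart.faceMonoid (𝒜.P i) (𝒜.φ i) (𝒜.primeAt i y hy)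

/-- A section is a unit in the stalk at `y` iff it is not in the prime of `y`.
[cite: Kato1994, (1.5)] -/
theorem isUnit_germ_iff (i : 𝒜.ι) (y : X) (hy : y ∈ (𝒜.U i : X.Opens))
    (s : Γ(X, (𝒜.U i : X.Opens))) :
    IsUnit (X.presheaf.germ (𝒜.U i : X.Opens) y hy s) ↔ s ∉ 𝒜.primeAt i y hy := by
  letI : Algebra Γ(X, (𝒜.U i : X.Opens)) (X.presheaf.stalk y) :=
    (X.presheaf.germ (𝒜.U i : X.Opens) y hy).hom.toAlgebra
  haveI : IsLocalization.AtPrime (X.presheaf.stalk y) (𝒜.primeAt i y hy) :=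
    (𝒜.U i).2.isLocalization_stalk ⟨y, hy⟩
  exact IsLocalization.AtPrime.isUnit_to_map_iff (X.presheaf.stalk y) (𝒜.primeAt i y hy) s

/-- `p ∈ F_{i,y}` iff `φ_i(p)` is a unit at `y`. [cite: Kato1994, (10.1)] -/
theorem coe_mem_faceAt_iff {i : 𝒜.ι} {y : X} (hy : y ∈ (𝒜.U i : X.Opens)) (p : 𝒜.P i) :
    (p : Fin (𝒜.n i) → ℤ) ∈ 𝒜.faceAt i y hy ↔
      IsUnit (X.presheaf.germ (𝒜.U i : X.Opens) y hy (𝒜.φ i (Multiplicative.ofAdd p))) := by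
  rw [faceAt, LogChart.mem_faceMonoid, LogChart.val_of_mem _ _ p.2, isUnit_germ_iff]
  exact ⟨fun h => h.2, fun h => ⟨p.2, h⟩⟩

/-- The face is contained in the chart monoid. [cite: Kato1994, (10.1)] -/
theorem faceAt_le (i : 𝒜.ι) (y : X) (hy : y ∈ (𝒜.U i : X.Opens)) : 𝒜.faceAt i y hy ≤ 𝒜.P i :=
  fun _ h => ((LogChart.mem_faceMonoid _ _ _).1 h).1

/-! ### Nizioł's Lemma 2.4 (1) at the stalk -/

/-- **Associated germs come from the face group**: if `φ_i(p)_y` and `φ_i(p')_y` are associated in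
`𝒪_{X,y}` then `p − p' ∈ ℤ F_{i,y}` (log regularity of the chart at the prime of `y`,
`LogChart.sub_mem_span_faceMonoid_of_isLogRegularAt`, transported along `𝒪_{X,y} ≅ Γ(X, U_i)_𝔭`).
[cite: Niziol2006, Lemma 2.4] [cite: Kato1994, (4.1)] -/
theorem sub_mem_span_faceAt_of_associated {i : 𝒜.ι} {y : X} (hy : y ∈ (𝒜.U i : X.Opens))
    (p p' : 𝒜.P i)
    (h : Associated (X.presheaf.germ (𝒜.U i : X.Opens) y hy (𝒜.φ i (Multiplicative.ofAdd p)))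
      (X.presheaf.germ (𝒜.U i : X.Opens) y hy (𝒜.φ i (Multiplicative.ofAdd p')))) :
    (p : Fin (𝒜.n i) → ℤ) - p' ∈ Submodule.span ℤ (𝒜.faceAt i y hy : Set (Fin (𝒜.n i) → ℤ)) := by
  letI : Algebra Γ(X, (𝒜.U i : X.Opens)) (X.presheaf.stalk y) :=
    (X.presheaf.germ (𝒜.U i : X.Opens) y hy).hom.toAlgebra
  haveI : IsLocalization.AtPrime (X.presheaf.stalk y) (𝒜.primeAt i y hy) :=
    (𝒜.U i).2.isLocalization_stalk ⟨y, hy⟩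
  let e : (X.presheaf.stalk y : Type u) ≃ₐ[Γ(X, (𝒜.U i : X.Opens))]
      Localization.AtPrime (𝒜.primeAt i y hy) :=
    IsLocalization.algEquiv (𝒜.primeAt i y hy).primeCompl _ _
  have he : ∀ s : Γ(X, (𝒜.U i : X.Opens)),
      e (X.presheaf.germ (𝒜.U i : X.Opens) y hy s) = algebraMap _ _ s := fun s => e.commutes s
  haveI := 𝒜.isNoetherianRing i
  obtain ⟨u, hu⟩ := h.symm
  -- `φ(p) = e(u) · φ(p')` in `Γ(X, U_i)_𝔭`
  have h1 : algebraMap _ (Localization.AtPrime (𝒜.primeAt i y hy)) (𝒜.φ i (Multiplicative.ofAdd p)) =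
      e ↑u * algebraMap _ _ (𝒜.φ i (Multiplicative.ofAdd p')) := by
    have := congrArg e hu
    rw [map_mul, he, he] at this
    rw [← this, mul_comm]
  exact LogChart.sub_mem_span_faceMonoid_of_isLogRegularAt (𝒜.fg i) (𝒜.saturated i)
    (𝒜.isLogRegularAt i _) p p' ((Units.isUnit u).map e) h1

/-! ### The partner relation between two charts at a point -/

section Link

variable {i j : 𝒜.ι} {y : X} (hi : y ∈ (𝒜.U i : X.Opens)) (hj : y ∈ (𝒜.U j : X.Opens))

/-- `p ∈ P_i` and `q ∈ P_j` are **partners at `y`** if their germs are associated in `𝒪_{X,y}`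
(they give the same element of `M_y/𝒪^*_y`). [cite: Kato1994, (1.5) and (10.1)] -/
def Rel (p : 𝒜.P i) (q : 𝒜.P j) : Prop :=
  Associated (X.presheaf.germ (𝒜.U i : X.Opens) y hi (𝒜.φ i (Multiplicative.ofAdd p)))
    (X.presheaf.germ (𝒜.U j : X.Opens) y hj (𝒜.φ j (Multiplicative.ofAdd q)))

/-- Every `p ∈ P_i` has a partner in `P_j` (the charts have the same stalk monoid).
[cite: Kato1994, (1.5)] -/
theorem exists_rel (p : 𝒜.P i) : ∃ q : 𝒜.P j, 𝒜.Rel hi hj p q := by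
  obtain ⟨q, hq⟩ := exists_associated_of_chartStalkMonoid_le (𝒜.φ i) (𝒜.φ j) y hi hj
    (𝒜.compat i j y hi hj).le (Multiplicative.ofAdd p)
  exact ⟨Multiplicative.toAdd q, hq⟩

/-- Every `q ∈ P_j` has a partner in `P_i`. [cite: Kato1994, (1.5)] -/
theorem exists_rel' (q : 𝒜.P j) : ∃ p : 𝒜.P i, 𝒜.Rel hi hj p q := by
  obtain ⟨p, hp⟩ := exists_associated_of_chartStalkMonoid_le (𝒜.φ j) (𝒜.φ i) y hj hi
    (𝒜.compat j i y hj hi).le (Multiplicative.ofAdd q)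
  exact ⟨Multiplicative.toAdd p, hp.symm⟩

variable {𝒜 hi hj}

/-- Partners add. [cite: Kato1994, (1.5)] -/
theorem Rel.add {p p' : 𝒜.P i} {q q' : 𝒜.P j} (h : 𝒜.Rel hi hj p q) (h' : 𝒜.Rel hi hj p' q') :
    𝒜.Rel hi hj (p + p') (q + q') := by
  unfold Rel at *
  rw [ofAdd_add, ofAdd_add, map_mul, map_mul, map_mul, map_mul]
  exact h.mul_mul h'

/-- `0 ~ 0`. [cite: Kato1994, (1.5)] -/
theorem Rel.zero : 𝒜.Rel hi hj (0 : 𝒜.P i) (0 : 𝒜.P j) := by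
  unfold Rel
  rw [ofAdd_zero, ofAdd_zero, map_one, map_one, map_one, map_one]

/-- Two partners of the same element differ by the face group (right). [cite: Niziol2006, Lemma 2.4] -/
theorem Rel.sub_mem_right {p : 𝒜.P i} {q q' : 𝒜.P j} (h : 𝒜.Rel hi hj p q) (h' : 𝒜.Rel hi hj p q') :
    (q : Fin (𝒜.n j) → ℤ) - q' ∈ Submodule.span ℤ (𝒜.faceAt j y hj : Set (Fin (𝒜.n j) → ℤ)) :=
  𝒜.sub_mem_span_faceAt_of_associated hj q q' (h.symm.trans h')

/-- Two partners of the same element differ by the face group (left). [cite: Niziol2006, Lemma 2.4] -/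
theorem Rel.sub_mem_left {p p' : 𝒜.P i} {q : 𝒜.P j} (h : 𝒜.Rel hi hj p q) (h' : 𝒜.Rel hi hj p' q) :
    (p : Fin (𝒜.n i) → ℤ) - p' ∈ Submodule.span ℤ (𝒜.faceAt i y hi : Set (Fin (𝒜.n i) → ℤ)) :=
  𝒜.sub_mem_span_faceAt_of_associated hi p p' (h.trans h'.symm)

/-- Partners are units together. [cite: Kato1994, (10.1)] -/
theorem Rel.mem_faceAt_iff {p : 𝒜.P i} {q : 𝒜.P j} (h : 𝒜.Rel hi hj p q) :
    (p : Fin (𝒜.n i) → ℤ) ∈ 𝒜.faceAt i y hi ↔ (q : Fin (𝒜.n j) → ℤ) ∈ 𝒜.faceAt j y hj := by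
  rw [coe_mem_faceAt_iff, coe_mem_faceAt_iff]
  exact h.isUnit_iff

/-! ### The additive link `θ : ℤ^{n_j} → ℤ^{n_i}` and its transpose -/

variable (𝒜 hi hj)

/-- A chosen partner in `P_i` of `q ∈ P_j`. [cite: Kato1994, (10.1)] -/
def partner (q : 𝒜.P j) : 𝒜.P i := (𝒜.exists_rel' hi hj q).choose

/-- The chosen partner is a partner. [cite: Kato1994, (10.1)] -/
theorem rel_partner (q : 𝒜.P j) : 𝒜.Rel hi hj (𝒜.partner hi hj q) q :=
  (𝒜.exists_rel' hi hj q).choose_spec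

/-- Additive maps from the chart monoid (which spans the lattice) into an abelian group extend to
the lattice (Kato (1.1): `P^{gp} = ℤⁿ`). [cite: Kato1994, (1.1)] -/
theorem exists_extend {n : ℕ} (S : AddSubmonoid (Fin n → ℤ))
    (hS : Submodule.span ℤ (S : Set (Fin n → ℤ)) = ⊤) {Q : Type*} [AddCommGroup Q] (ψ : S →+ Q) :
    ∃ Ψ : (Fin n → ℤ) →+ Q, ∀ (s : Fin n → ℤ) (hs : s ∈ S), Ψ s = ψ ⟨s, hs⟩ := by
  obtain ⟨Θ, hΘ⟩ := LogRefinedChart.exists_addMonoidHom_extend S hS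
    (G := Multiplicative Q) (AddMonoidHom.toMultiplicative ψ)
  refine ⟨AddMonoidHom.mk' (fun x => Multiplicative.toAdd (Additive.toMul (Θ x))) fun a b => ?_, ?_⟩
  · rw [map_add, toMul_add, toAdd_mul]
  · intro s hs
    show Multiplicative.toAdd (Additive.toMul (Θ s)) = ψ ⟨s, hs⟩
    rw [hΘ s hs]
    rfl

/-- A presentation of the basis vectors as differences of chart elements, and chosen partners:
the vector `v_k = partner(a_k) − partner(b_k)` where `e_k = a_k − b_k`, `a_k, b_k ∈ P_j`.
[cite: Kato1994, (10.1)] -/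
def linkVec (k : Fin (𝒜.n j)) : Fin (𝒜.n i) → ℤ :=
  let h := (LogChart.mem_span_int_iff_exists_sub (𝒜.P j)).1
    (show Pi.single k (1 : ℤ) ∈ Submodule.span ℤ (𝒜.P j : Set (Fin (𝒜.n j) → ℤ)) by
      rw [𝒜.span_eq_top j]; exact Submodule.mem_top)
  (𝒜.partner hi hj ⟨h.choose, h.choose_spec.1⟩ : Fin (𝒜.n i) → ℤ) -
    (𝒜.partner hi hj ⟨h.choose_spec.2.choose, h.choose_spec.2.choose_spec.1⟩ : Fin (𝒜.n i) → ℤ)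

/-- **The additive link** `θ : ℤ^{n_j} → ℤ^{n_i}`, `e_k ↦ v_k`: an additive lift of
`q ↦ (partner of q) mod ℤF_{i,y}` from `P_j` (which spans `ℤ^{n_j}`) to the lattice
(`linkHom_sub_partner_mem`). [cite: Kato1994, (10.1)] -/
def linkHom : (Fin (𝒜.n j) → ℤ) →ₗ[ℤ] (Fin (𝒜.n i) → ℤ) :=
  (Pi.basisFun ℤ (Fin (𝒜.n j))).constr ℤ (𝒜.linkVec hi hj)

/-- `θ(e_k) = v_k`. [cite: Kato1994, (10.1)] -/
theorem linkHom_single (k : Fin (𝒜.n j)) :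
    𝒜.linkHom hi hj (Pi.single k 1) = 𝒜.linkVec hi hj k := by
  have := (Pi.basisFun ℤ (Fin (𝒜.n j))).constr_basis ℤ (𝒜.linkVec hi hj) k
  rwa [Pi.basisFun_apply] at this

/-- **`θ` lifts the partner relation**: for `q ∈ P_j` with partner `p ∈ P_i`,
`θ q − p ∈ ℤ F_{i,y}`. [cite: Kato1994, (10.1)] [cite: Niziol2006, Lemma 2.4] -/
theorem linkHom_sub_mem {p : 𝒜.P i} {q : 𝒜.P j} (h : 𝒜.Rel hi hj p q) :
    𝒜.linkHom hi hj (q : Fin (𝒜.n j) → ℤ) - p ∈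
      Submodule.span ℤ (𝒜.faceAt i y hi : Set (Fin (𝒜.n i) → ℤ)) := by
  classical
  set W := Submodule.span ℤ (𝒜.faceAt i y hi : Set (Fin (𝒜.n i) → ℤ)) with hW
  -- the partner class map `ψ : P_j → ℤ^{n_i}/W` and its additive extension `Ψ`
  let ψ : 𝒜.P j →+ (Fin (𝒜.n i) → ℤ) ⧸ W :=
    { toFun := fun q => Submodule.Quotient.mk (𝒜.partner hi hj q : Fin (𝒜.n i) → ℤ)
      map_zero' := by
        rw [Submodule.Quotient.mk_eq_zero]
        have h0 := (𝒜.rel_partner hi hj 0).sub_mem_left Rel.zero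
        rwa [ZeroMemClass.coe_zero, sub_zero] at h0
      map_add' := fun q q' => by
        rw [← Submodule.Quotient.mk_add, Submodule.Quotient.eq, ← AddSubmonoid.coe_add]
        exact (𝒜.rel_partner hi hj _).sub_mem_left
          ((𝒜.rel_partner hi hj _).add (𝒜.rel_partner hi hj _)) }
  have hψ : ∀ (p : 𝒜.P i) (q : 𝒜.P j), 𝒜.Rel hi hj p q →
      ψ q = Submodule.Quotient.mk (p : Fin (𝒜.n i) → ℤ) := by
    intro p q hpq
    show Submodule.Quotient.mk (𝒜.partner hi hj q : Fin (𝒜.n i) → ℤ) = _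
    rw [Submodule.Quotient.eq]
    exact (𝒜.rel_partner hi hj q).sub_mem_left hpq
  obtain ⟨Ψ, hΨ⟩ := exists_extend (𝒜.P j) (𝒜.span_eq_top j) ψ
  -- `mkQ ∘ θ = Ψ`: compare on the basis vectors
  have hcomp : (W.mkQ.toAddMonoidHom).comp (𝒜.linkHom hi hj).toAddMonoidHom = Ψ := by
    refine AddMonoidHom.functions_ext _ _ _ fun k c => ?_
    have hsingle : (Pi.single k c : Fin (𝒜.n j) → ℤ) = c • Pi.single k 1 := by
      funext b; rcases eq_or_ne b k with rfl | hb
      · simp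
      · simp [hb]
    show W.mkQ (𝒜.linkHom hi hj (Pi.single k c)) = Ψ (Pi.single k c)
    rw [hsingle, map_zsmul, map_zsmul, map_zsmul, linkHom_single]
    congr 1
    -- `mkQ v_k = Ψ e_k = ψ a_k − ψ b_k`
    unfold linkVec
    set hh := (LogChart.mem_span_int_iff_exists_sub (𝒜.P j)).1
      (show Pi.single k (1 : ℤ) ∈ Submodule.span ℤ (𝒜.P j : Set (Fin (𝒜.n j) → ℤ)) by
        rw [𝒜.span_eq_top j]; exact Submodule.mem_top) with hhh
    have hk : (Pi.single k (1 : ℤ) : Fin (𝒜.n j) → ℤ) = hh.choose - hh.choose_spec.2.choose :=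
      hh.choose_spec.2.choose_spec.2
    rw [Submodule.mkQ_apply, Submodule.Quotient.mk_sub]
    conv_rhs => rw [hk, map_sub, hΨ _ hh.choose_spec.1, hΨ _ hh.choose_spec.2.choose_spec.1]
    rfl
  have hq : W.mkQ (𝒜.linkHom hi hj (q : Fin (𝒜.n j) → ℤ)) = Ψ (q : Fin (𝒜.n j) → ℤ) := by
    rw [← hcomp]; rfl
  rw [hΨ _ q.2, Subtype.coe_eta, hψ p q h, Submodule.mkQ_apply, Submodule.Quotient.eq] at hq
  exact hq

/-- **The rational link** `E : ℚ^{n_i} → ℚ^{n_j}`, the transpose of `θ`: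
`(E v)_a = ⟨θ(e_a), v⟩`. [cite: Kato1994, (10.1)] -/
def linkMap : (Fin (𝒜.n i) → ℚ) →ₗ[ℚ] (Fin (𝒜.n j) → ℚ) where
  toFun v := fun a => toRat (𝒜.linkHom hi hj (Pi.single a 1)) ⬝ᵥ v
  map_add' v w := by funext a; simp only [dotProduct_add, Pi.add_apply]
  map_smul' c v := by funext a; simp only [dotProduct_smul, Pi.smul_apply, RingHom.id_apply]

/-- `(E v)_a = ⟨θ(e_a), v⟩`. [cite: Kato1994, (10.1)] -/
theorem linkMap_apply (v : Fin (𝒜.n i) → ℚ) (a : Fin (𝒜.n j)) :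
    𝒜.linkMap hi hj v a = toRat (𝒜.linkHom hi hj (Pi.single a 1)) ⬝ᵥ v := rfl

/-- **Transpose identity**: `⟨x, E v⟩ = ⟨θ x, v⟩` for lattice vectors `x`. [cite: Kato1994, (10.1)] -/
theorem dotProduct_linkMap (x : Fin (𝒜.n j) → ℤ) (v : Fin (𝒜.n i) → ℚ) :
    toRat x ⬝ᵥ 𝒜.linkMap hi hj v = toRat (𝒜.linkHom hi hj x) ⬝ᵥ v := by
  classical
  -- both sides are additive in `x`; compare on `Pi.single a c`
  let L : (Fin (𝒜.n j) → ℤ) →+ ℚ :=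
    { toFun := fun x => toRat x ⬝ᵥ 𝒜.linkMap hi hj v
      map_zero' := by simp only [toRat_zero, zero_dotProduct]
      map_add' := fun a b => by simp only [toRat_add, add_dotProduct] }
  let R : (Fin (𝒜.n j) → ℤ) →+ ℚ :=
    { toFun := fun x => toRat (𝒜.linkHom hi hj x) ⬝ᵥ v
      map_zero' := by simp only [map_zero, toRat_zero, zero_dotProduct]
      map_add' := fun a b => by simp only [map_add, toRat_add, add_dotProduct] }
  suffices h : L = R from DFunLike.congr_fun h x
  refine AddMonoidHom.functions_ext _ _ _ fun a c => ?_
  show toRat (Pi.single a c) ⬝ᵥ 𝒜.linkMap hi hj v = toRat (𝒜.linkHom hi hj (Pi.single a c)) ⬝ᵥ v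
  have hsingle : (Pi.single a c : Fin (𝒜.n j) → ℤ) = c • Pi.single a 1 := by
    funext b; rcases eq_or_ne b a with rfl | hb
    · simp
    · simp [hb]
  have htoRat : toRat (Pi.single a c : Fin (𝒜.n j) → ℤ) = (c : ℚ) • Pi.single a (1 : ℚ) := by
    funext b
    simp only [toRat, Pi.smul_apply, smul_eq_mul, Pi.single_apply]
    split_ifs <;> simp
  rw [htoRat, smul_dotProduct, single_one_dotProduct, linkMap_apply, hsingle, map_zsmul]
  have : toRat (c • 𝒜.linkHom hi hj (Pi.single a 1)) =
      (c : ℚ) • toRat (𝒜.linkHom hi hj (Pi.single a 1)) := by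
    funext b; simp only [toRat, Pi.smul_apply, smul_eq_mul, Int.cast_mul]
  rw [this, smul_dotProduct]

/-! ### The link is a lattice isomorphism of the faces at `y` -/

/-- **Pairing identity**: for partners `p ~ q` at `y` and `v ⊥ F_{i,y}`, `⟨q, E v⟩ = ⟨p, v⟩`.
[cite: Kato1994, (10.1)] -/
theorem linkMap_pairing {v : Fin (𝒜.n i) → ℚ}
    (hv : ∀ f ∈ 𝒜.faceAt i y hi, toRat f ⬝ᵥ v = 0) {p : 𝒜.P i} {q : 𝒜.P j}
    (h : 𝒜.Rel hi hj p q) :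
    toRat (q : Fin (𝒜.n j) → ℤ) ⬝ᵥ 𝒜.linkMap hi hj v = toRat (p : Fin (𝒜.n i) → ℤ) ⬝ᵥ v := by
  rw [dotProduct_linkMap]
  -- `θ q − p ∈ ℤF_{i,y}` pairs to zero with `v`
  have hW : ∀ x ∈ Submodule.span ℤ (𝒜.faceAt i y hi : Set (Fin (𝒜.n i) → ℤ)), toRat x ⬝ᵥ v = 0 := by
    intro x hx
    induction hx using Submodule.span_induction with
    | mem x hx => exact hv x hx
    | zero => simp only [toRat_zero, zero_dotProduct]
    | add x y _ _ hx hy => rw [toRat_add, add_dotProduct, hx, hy, add_zero]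
    | smul a x _ hx =>
      have : toRat (a • x) = (a : ℚ) • toRat x := by
        funext b; simp only [toRat, Pi.smul_apply, smul_eq_mul, Int.cast_mul]
      rw [this, smul_dotProduct, hx, smul_zero]
  have h0 := hW _ (𝒜.linkHom_sub_mem hi hj h)
  have hsub : toRat (𝒜.linkHom hi hj (q : Fin (𝒜.n j) → ℤ) - (p : Fin (𝒜.n i) → ℤ)) =
      toRat (𝒜.linkHom hi hj (q : Fin (𝒜.n j) → ℤ)) - toRat (p : Fin (𝒜.n i) → ℤ) := by
    funext b; simp only [toRat, Pi.sub_apply, Int.cast_sub]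
  rw [hsub, sub_dotProduct, sub_eq_zero] at h0
  exact h0

/-- `E` maps `F_{i,y}^⊥` into `F_{j,y}^⊥`. [cite: Kato1994, (10.1)] -/
theorem linkMap_orth {v : Fin (𝒜.n i) → ℚ} (hv : ∀ f ∈ 𝒜.faceAt i y hi, toRat f ⬝ᵥ v = 0) :
    ∀ g ∈ 𝒜.faceAt j y hj, toRat g ⬝ᵥ 𝒜.linkMap hi hj v = 0 := by
  intro g hg
  have hgP : g ∈ 𝒜.P j := 𝒜.faceAt_le j y hj hg
  obtain ⟨p, hp⟩ := 𝒜.exists_rel' hi hj ⟨g, hgP⟩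
  rw [𝒜.linkMap_pairing hi hj hv hp]
  exact hv _ ((hp.mem_faceAt_iff).2 hg)

/-- `E` maps `F_{i,y}^⊥ ∩ P_i^∨` into `P_j^∨`. [cite: Kato1994, (10.1)] -/
theorem linkMap_nonneg {v : Fin (𝒜.n i) → ℚ} (hv : ∀ f ∈ 𝒜.faceAt i y hi, toRat f ⬝ᵥ v = 0)
    (hσ : ∀ p : 𝒜.P i, 0 ≤ toRat (p : Fin (𝒜.n i) → ℤ) ⬝ᵥ v) (q : 𝒜.P j) :
    0 ≤ toRat (q : Fin (𝒜.n j) → ℤ) ⬝ᵥ 𝒜.linkMap hi hj v := by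
  obtain ⟨p, hp⟩ := 𝒜.exists_rel' hi hj q
  rw [𝒜.linkMap_pairing hi hj hv hp]
  exact hσ p

/-- `E` maps lattice vectors to lattice vectors. [cite: Kato1994, (10.1)] -/
theorem linkMap_integral (v : Fin (𝒜.n i) → ℤ) :
    𝒜.linkMap hi hj (toRat v) = toRat (fun a => 𝒜.linkHom hi hj (Pi.single a 1) ⬝ᵥ v) := by
  funext a
  rw [linkMap_apply]
  simp only [toRat, dotProduct, Int.cast_sum, Int.cast_mul]

/-- **The links are mutually inverse on the faces**: for `v ⊥ F_{i,y}`,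
`E_{ji}(E_{ij} v) = v`. [cite: Kato1994, (10.1)] -/
theorem linkMap_linkMap {v : Fin (𝒜.n i) → ℚ} (hv : ∀ f ∈ 𝒜.faceAt i y hi, toRat f ⬝ᵥ v = 0) :
    𝒜.linkMap hj hi (𝒜.linkMap hi hj v) = v := by
  -- pair with the spanning set `P_i`
  have key : ∀ p : 𝒜.P i, toRat (p : Fin (𝒜.n i) → ℤ) ⬝ᵥ 𝒜.linkMap hj hi (𝒜.linkMap hi hj v) =
      toRat (p : Fin (𝒜.n i) → ℤ) ⬝ᵥ v := by
    intro p
    obtain ⟨q, hq⟩ := 𝒜.exists_rel hi hj p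
    have hq' : 𝒜.Rel hj hi q p := hq.symm
    rw [𝒜.linkMap_pairing hj hi (𝒜.linkMap_orth hi hj hv) hq', 𝒜.linkMap_pairing hi hj hv hq]
  -- a vector is determined by its pairings with `P_i` (which spans `ℤ^{n_i}`)
  have hall : ∀ x : Fin (𝒜.n i) → ℤ, toRat x ⬝ᵥ (𝒜.linkMap hj hi (𝒜.linkMap hi hj v) - v) = 0 := by
    intro x
    have hx : x ∈ Submodule.span ℤ (𝒜.P i : Set (Fin (𝒜.n i) → ℤ)) := by
      rw [𝒜.span_eq_top i]; exact Submodule.mem_top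
    obtain ⟨a, ha, b, hb, rfl⟩ := (LogChart.mem_span_int_iff_exists_sub (𝒜.P i)).1 hx
    have hsub : toRat (a - b) = toRat a - toRat b := by
      funext c; simp only [toRat, Pi.sub_apply, Int.cast_sub]
    rw [hsub, sub_dotProduct, dotProduct_sub, dotProduct_sub, key ⟨a, ha⟩, key ⟨b, hb⟩]
    ring
  funext c
  have h1 := hall (Pi.single c 1)
  have hs : toRat (Pi.single c (1 : ℤ) : Fin (𝒜.n i) → ℤ) = Pi.single c (1 : ℚ) := by
    funext b; simp only [toRat, Pi.single_apply]; split_ifs <;> simp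
  rw [hs, single_one_dotProduct, Pi.sub_apply, sub_eq_zero] at h1
  exact h1

end Link

end LogRegularAtlas

end Literature.AlgebraicGeometry.Resolution
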